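import Summits.Ventures.AbcShadow.SH04.TwoSigned
import Summits.Ventures.AbcShadow.SH04.PairRow

/-!
# Venture AbcShadow — SH-04 GENERIC ROW for a pair `(p, n)` of [BVY04, Thm 1.6] WITHOUT L\* orbits, ALLOWED-SET-PARAMETRIC

HONEST FRAMING. A row template of the work-bound cell `abc-shadow` (typer seat `abc-shadow-typ-1`, lineage g5): a CONDITIONAL,
typed/kernel-checked REDUCTION, no claim on abc or on any summit, no side on IUT. It is `SH04/PairRowA.lean` (`bvy16A_core`,
`bvy16A_pair_of_not_dvd`, `bvy16A_pair`) with ONE change: the L\* alternative at the level `27p` is REMOVED — every orbit of all three levels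
`3p / 9p / 27p` is required to be kernel-eliminated (`∀ o ∈ L₂₇, o.Eliminated Aset n`), so the theorems do NOT take [BVY04, Prop 4.3]
(`BVY04Prop43`), the rank inputs (`BVY04RankInput39`) or any `LStarTransferA` as hypotheses. REASON: for the pair `(59, 11)` (print's listed
exception, `SH04/Row59_11B.lean`) every orbit of levels 177 / 531 / 1593 dies by a kernel certificate; instantiating `bvy16A_pair` would carry
[Prop 4.3] as an IDLE hypothesis (as recorded for `(47, 13)` in `SH04/Row47_13B.lean`); this template keeps the hypothesis list of such rows
minimal: `BVY04PackageA Aset` (CITED, as amended when `Aset = bvy04Allowed`), `DataComplete ×3` (COMPUTED), [DM97] for `n ∣ α` (CITED).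
Proof texts are those of `SH04/PairRowA.lean` verbatim except that the `27p` branch is closed like the `3p / 9p` branches. Kernel content and
named inputs otherwise as listed in `SH04/PairRow.lean`. Words: typed/kernel-checked REDUCTION; the newform data is COMPUTED and enters as
`DataComplete`; print inputs are NAMED hypotheses; adjacent (signature (n,n,3)), NOT abc; no side on IUT. AI-typed; weaker than expert
refereeing of the cited inputs.
-/

namespace Summit.Ventures.AbcShadow

open Summit.Ventures.AbcSig (NewformModel FreyDatum OrbitData)
open Literature.NumberTheory.DiophantineGeometry (darmonMerel1997_sumOfPowersEqCube)

/-! ## The core: a datum in print's normal form at the levels `3p / 9p / 27p`, all three fully sieved -/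

/-- **Core of the generic row WITHOUT L\* orbits, allowed-set-parametric** (= `bvy16A_core` of `SH04/PairRowA.lean` with the L\* alternative
removed: every orbit of ALL THREE levels is kernel-eliminated, so [BVY04, Prop 4.3] and the rank inputs are NOT hypotheses; proof text otherwise
byte-identical). `p ≠ 3` prime, `n ≥ 11` prime, `p ≠ n`; levels `N₃ = 3p`, `N₉ = 9p`, `N₂₇ = 27p` with orbit lists `L₃, L₉, L₂₇` (entries at
odd primes not dividing the level), every orbit of each list kernel-eliminated at `n` for the allowed sets `Aset`. Then under
`BVY04PackageA Aset` and `DataComplete ×3` there is no datum `A aⁿ + B bⁿ = c³` with `A·B = p^e`, `1 ≤ e < n`, `Aa, Bb, c` pairwise coprime and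
nonzero, `3 ∤ Aa`, `Bbⁿ ≢ 2 (mod 3)`, `ab ≠ ±1`. CASE TREE: [L.3.4 + Cor 3.3] give a newform `f` of level `3p` (`3 ∣ b`), `9p`
(`9 ∣ 2 + Bbⁿ − 3c`) or `27p` (`3 ∥ 2 + Bbⁿ − 3c`) with the [Prop 4.2] congruences at `n`; `DataComplete` puts `f` in a listed orbit; a kernel
tree kills it. [cite: BennettVatsalYazdani2004, Lemma 3.4 p.1406, Cor 3.3 p.1405, Prop 4.2 pp.1406-1407] -/
theorem bvy16A0_core (p n : ℕ) (hp : p.Prime) (hp3 : p ≠ 3) (hn : n.Prime) (h11 : 11 ≤ n) (hpn : p ≠ n)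
    (M : CMNewformModel) (Aset : ℕ → List ℤ) (hP : M.BVY04PackageA Aset)
    {N₃ N₉ N₂₇ : ℕ} (h3p : 3 * p = N₃) (h9p : 9 * p = N₉) (h27p : 27 * p = N₂₇) (L₃ L₉ L₂₇ : List OrbitData)
    (hw3 : ∀ o ∈ L₃, ∀ c ∈ o.coeffs, c.ell.Prime ∧ c.ell ≠ 2 ∧ ¬ c.ell ∣ N₃)
    (hw9 : ∀ o ∈ L₉, ∀ c ∈ o.coeffs, c.ell.Prime ∧ c.ell ≠ 2 ∧ ¬ c.ell ∣ N₉)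
    (hw27 : ∀ o ∈ L₂₇, ∀ c ∈ o.coeffs, c.ell.Prime ∧ c.ell ≠ 2 ∧ ¬ c.ell ∣ N₂₇)
    (he3 : ∀ o ∈ L₃, o.Eliminated Aset n) (he9 : ∀ o ∈ L₉, o.Eliminated Aset n) (he27 : ∀ o ∈ L₂₇, o.Eliminated Aset n)
    (hD3 : M.DataComplete N₃ L₃) (hD9 : M.DataComplete N₉ L₉) (hD27 : M.DataComplete N₂₇ L₂₇)
    {A B e : ℕ} (he1 : 1 ≤ e) (hen : e < n) (hAB : A * B = p ^ e) {a b c : ℤ}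
    (hsol : IsPrimitiveSolution A B 1 n a b c) (h3a : ¬ (3 : ℤ) ∣ (A : ℤ) * a)
    (h3b : ¬ (3 : ℤ) ∣ (B : ℤ) * b ^ n - 2) (hab1 : a * b ≠ 1) (hab2 : a * b ≠ -1) : False := by
  -- arithmetic of the coefficients
  have hpe : 0 < p ^ e := Nat.pow_pos hp.pos
  have hA0 : 0 < A := Nat.pos_of_ne_zero (fun h => by rw [h, zero_mul] at hAB; omega)
  have hB0 : 0 < B := Nat.pos_of_ne_zero (fun h => by rw [h, mul_zero] at hAB; omega)
  have hAdvd : A ∣ p ^ e := Dvd.intro _ hAB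
  have hBdvd : B ∣ p ^ e := Dvd.intro_left _ hAB
  have hfree : ∀ D : ℕ, D ∣ p ^ e → ∀ q : ℕ, q.Prime → ¬ q ^ n ∣ D := by
    intro D hD q hq h
    have hqp : q ∣ p ^ e := (dvd_pow_self q (by omega : n ≠ 0)).trans (h.trans hD)
    have hq : q = p := (Nat.prime_dvd_prime_iff_eq hq hp).mp (hq.dvd_of_dvd_pow hqp)
    subst hq
    have := (Nat.pow_dvd_pow_iff_le_right hq.one_lt).mp (h.trans hD)
    omega
  have hcube : ∀ q : ℕ, q.Prime → ¬ q ^ 3 ∣ 1 := by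
    intro q hq h
    have : q ^ 3 = 1 := Nat.dvd_one.mp h
    rcases pow_eq_one_iff.mp this with h1 | h0
    · exact hq.one_lt.ne' h1
    · exact absurd h0 (by norm_num)
  have hnABC : ¬ n ∣ A * B * 1 := by
    rw [mul_one, hAB]
    intro h
    exact hpn ((Nat.prime_dvd_prime_iff_eq hn hp).mp (hn.dvd_of_dvd_pow h)).symm
  have h3B : ¬ (3 : ℤ) ∣ (B : ℤ) := by
    intro h
    have h' : 3 ∣ B := by exact_mod_cast h
    exact hp3 ((Nat.prime_dvd_prime_iff_eq Nat.prime_three hp).mp (Nat.prime_three.dvd_of_dvd_pow (h'.trans hBdvd))).symm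
  obtain ⟨hL3, hL9, hL27⟩ := bvy04Level_pair p hp hp3 A B e (by omega) hAB
  have h5 : 5 ≤ n := by omega
  have hex1 : ¬ (A * B = 27 ∧ n = 5) := fun h => by omega
  have hex2 : ¬ (A * B = 3 ∧ n = 7) := fun h => by omega
  let S : FreyDatum := ⟨A, B, 1, n, a, b, c⟩
  have hpkg : ∀ (κ : BVYCase) (N : ℕ), κ.Holds A B 1 n a b c → bvy04Level κ A B 1 = N →
      (∃ f : M.Form N, M.Arises S N f) ∧ (∀ f : M.Form N, M.Arises S N f → M.ArisesMod f n Aset) :=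
    fun κ N hκ hN => hP S κ hA0 hB0 Nat.one_pos hcube (fun q hq => ⟨hfree A hAdvd q hq, hfree B hBdvd q hq⟩)
      hn h5 hnABC h3a h3b hsol hab1 hab2 hex1 hex2 hκ N hN
  -- a fully sieved level kills every newform carrying the congruences
  have killAll : ∀ (N : ℕ) (L : List OrbitData), (∀ o ∈ L, ∀ c ∈ o.coeffs, c.ell.Prime ∧ c.ell ≠ 2 ∧ ¬ c.ell ∣ N) →
      (∀ o ∈ L, o.Eliminated Aset n) → M.DataComplete N L →
      ∀ f : M.Form N, M.ArisesMod f n Aset → False := by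
    intro N L hw he hD f hmod
    obtain ⟨o, ho, hfo⟩ := hD f
    exact M.not_arisesMod_of_eliminated f o hfo n Aset (he o ho) (hw o ho) hmod
  -- the case tree of [Cor 3.3]
  by_cases h3 : (3 : ℤ) ∣ (B : ℤ) * b
  · -- `3 ∣ b`: row `ε′₃ = 3`, level `3p`
    have h3b' : (3 : ℤ) ∣ b := (Int.prime_three.dvd_or_dvd h3).resolve_left h3B
    have hκ : BVYCase.bLarge.Holds A B 1 n a b c := by
      refine ⟨?_, ?_⟩
      · exact Dvd.dvd.mul_left ((pow_dvd_pow (3 : ℤ) (by omega : 4 ≤ n)).trans (pow_dvd_pow_of_dvd h3b' n)) _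
      · rintro ⟨h27, -⟩
        exact h3B ((dvd_pow_self 3 (by norm_num)).trans h27)
    obtain ⟨⟨f, hf⟩, hmod⟩ := hpkg .bLarge N₃ hκ (hL3.trans h3p)
    exact killAll N₃ L₃ hw3 he3 hD3 f (hmod f hf)
  · have h3b'' : ¬ (3 : ℤ) ∣ b := fun h => h3 (Dvd.dvd.mul_left h _)
    have h3bn : ¬ (3 : ℤ) ∣ (B : ℤ) * b ^ n := by
      intro h
      rcases Int.prime_three.dvd_or_dvd h with h' | h'
      · exact h3B h'
      · exact h3b'' (Int.Prime.dvd_pow' (by norm_num) h')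
    have hdiv : (3 : ℤ) ∣ 2 + (B : ℤ) * b ^ n - 3 * c := by
      omega
    by_cases h9 : (9 : ℤ) ∣ 2 + (B : ℤ) * b ^ n - 3 * c
    · -- row `ε′₃ = 3²`, level `9p`
      obtain ⟨⟨f, hf⟩, hmod⟩ := hpkg .nine N₉ (by simpa [BVYCase.Holds] using h9) (hL9.trans h9p)
      exact killAll N₉ L₉ hw9 he9 hD9 f (hmod f hf)
    · -- row `ε′₃ = 3³`, level `27p` (fully sieved as well: no L\* orbit)
      have hκ : BVYCase.three.Holds A B 1 n a b c := ⟨by simpa using hdiv, by simpa using h9⟩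
      obtain ⟨⟨f, hf⟩, hmod⟩ := hpkg .three N₂₇ hκ (hL27.trans h27p)
      exact killAll N₂₇ L₂₇ hw27 he27 hD27 f (hmod f hf)

/-! ## The generic row -/

/-- **Generic row for `n ∤ α`, allowed-set-parametric, no L\* orbit (no Darmon–Merel input, no Prop 4.3).** Under the hypotheses of
`bvy16A0_core`, `xⁿ + p^α yⁿ = z³` has no solution in pairwise coprime integers with `|xy| > 1` when `n ∤ α`, `α ≥ 1`. Kernel steps (uniform in
`(p, n)`, byte-identical to `bvy16A_pair_of_not_dvd`): `p ∤ xz`; `α = nk + e`, `Y = p^k y`, `1 ≤ e < n`; coprimality of `(x, p^{e+k} y, z)`;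
`|xY| > 1`; print's normal form via `(A,a) ↔ (B,b)` (`3 ∣ x`) and `(a,b,c) ↦ (−a,−b,−c)` (`p^e Yⁿ ≡ 2 (mod 3)`); then `bvy16A0_core`.
[cite: BennettVatsalYazdani2004, Thm 1.6 p.1400 (one pair (p,n)); Lemma 3.4, Cor 3.3, Prop 4.2] -/
theorem bvy16A0_pair_of_not_dvd (p n : ℕ) (hp : p.Prime) (hp3 : p ≠ 3) (hn : n.Prime) (h11 : 11 ≤ n) (hpn : p ≠ n)
    (M : CMNewformModel) (Aset : ℕ → List ℤ) (hP : M.BVY04PackageA Aset)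
    {N₃ N₉ N₂₇ : ℕ} (h3p : 3 * p = N₃) (h9p : 9 * p = N₉) (h27p : 27 * p = N₂₇) (L₃ L₉ L₂₇ : List OrbitData)
    (hw3 : ∀ o ∈ L₃, ∀ c ∈ o.coeffs, c.ell.Prime ∧ c.ell ≠ 2 ∧ ¬ c.ell ∣ N₃)
    (hw9 : ∀ o ∈ L₉, ∀ c ∈ o.coeffs, c.ell.Prime ∧ c.ell ≠ 2 ∧ ¬ c.ell ∣ N₉)
    (hw27 : ∀ o ∈ L₂₇, ∀ c ∈ o.coeffs, c.ell.Prime ∧ c.ell ≠ 2 ∧ ¬ c.ell ∣ N₂₇)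
    (he3 : ∀ o ∈ L₃, o.Eliminated Aset n) (he9 : ∀ o ∈ L₉, o.Eliminated Aset n) (he27 : ∀ o ∈ L₂₇, o.Eliminated Aset n)
    (hD3 : M.DataComplete N₃ L₃) (hD9 : M.DataComplete N₉ L₉) (hD27 : M.DataComplete N₂₇ L₂₇)
    (α : ℕ) (hα : 0 < α) (hnα : ¬ n ∣ α) (x y z : ℤ) (hxy : IsCoprime x y) (hxz : IsCoprime x z)
    (hyz : IsCoprime y z) (hbig : 1 < |x * y|) (heq : x ^ n + (p : ℤ) ^ α * y ^ n = z ^ 3) : False := by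
  have hn0 : 0 < n := by omega
  have hodd : Odd n := hn.odd_of_ne_two (by omega)
  obtain ⟨hpx, hpz⟩ := sh04_prime_not_dvd hp hα hn0 hxz heq
  -- `α = n k + e`, `1 ≤ e < n`
  set k := α / n with hk
  set e := α % n with he
  have hαke : α = n * k + e := (Nat.div_add_mod α n).symm
  have he1 : 1 ≤ e := Nat.pos_of_ne_zero (fun h0 => hnα (Nat.dvd_of_mod_eq_zero h0))
  have hen : e < n := Nat.mod_lt α hn0
  set Y : ℤ := (p : ℤ) ^ k * y with hY
  have hpow : (p : ℤ) ^ α * y ^ n = ((p ^ e : ℕ) : ℤ) * Y ^ n := by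
    rw [hαke, hY]; push_cast; ring
  -- nonvanishing and coprimality
  have hx0 : x ≠ 0 := by rintro rfl; simp at hbig
  have hy0 : y ≠ 0 := by rintro rfl; simp at hbig
  have hz0 : z ≠ 0 := by
    rintro rfl
    have hx1 := Int.isUnit_iff_abs_eq.mp (isCoprime_zero_right.mp hxz)
    have hy1 := Int.isUnit_iff_abs_eq.mp (isCoprime_zero_right.mp hyz)
    rw [abs_mul, hx1, hy1] at hbig
    norm_num at hbig
  have pP : Prime (p : ℤ) := Int.prime_iff_natAbs_prime.mpr (by simpa using hp)
  have hcpx : IsCoprime (p : ℤ) x := pP.irreducible.coprime_iff_not_dvd.mpr hpx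
  have hcpz : IsCoprime (p : ℤ) z := pP.irreducible.coprime_iff_not_dvd.mpr hpz
  have hBY : ((p ^ e : ℕ) : ℤ) * Y = (p : ℤ) ^ (e + k) * y := by rw [hY]; push_cast; ring
  have hxBY : IsCoprime x (((p ^ e : ℕ) : ℤ) * Y) := by
    rw [hBY]
    exact (hcpx.symm.pow_right).mul_right hxy
  have hBYz : IsCoprime (((p ^ e : ℕ) : ℤ) * Y) z := by
    rw [hBY]
    exact (hcpz.pow_left).mul_left hyz
  have hBY0 : ((p ^ e : ℕ) : ℤ) * Y ≠ 0 := by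
    rw [hBY]; exact mul_ne_zero (pow_ne_zero _ (by exact_mod_cast hp.ne_zero)) hy0
  have h1p : (1 : ℤ) ≤ |(p : ℤ)| := by
    rw [Nat.abs_cast]; exact_mod_cast hp.one_lt.le
  have hxY : x * Y ≠ 1 ∧ x * Y ≠ -1 := by
    have hlt : 1 < |x * Y| := by
      rw [hY, show x * ((p : ℤ) ^ k * y) = (p : ℤ) ^ k * (x * y) by ring, abs_mul]
      calc (1 : ℤ) = 1 * 1 := by norm_num
        _ < |(p : ℤ) ^ k| * |x * y| := by
          apply mul_lt_mul' _ hbig (by norm_num) (abs_pos.mpr (pow_ne_zero _ (by exact_mod_cast hp.ne_zero)))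
          rw [abs_pow]; exact one_le_pow₀ h1p
    constructor <;> intro h <;> rw [h] at hlt <;> norm_num at hlt
  have heq' : x ^ n + ((p ^ e : ℕ) : ℤ) * Y ^ n = z ^ 3 := by rw [← hpow]; exact heq
  have hAB1 : 1 * p ^ e = p ^ e := one_mul _
  have hAB2 : p ^ e * 1 = p ^ e := mul_one _
  have hnx : (-x) ^ n = -(x ^ n) := Odd.neg_pow hodd x
  have hnY : (-Y) ^ n = -(Y ^ n) := Odd.neg_pow hodd Y
  have hnz : (-z) ^ 3 = -(z ^ 3) := Odd.neg_pow (by decide) z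
  -- print's normal form
  by_cases h3x : (3 : ℤ) ∣ x
  · -- swap: `A = p^e`, `a = Y`, `B = 1`, `b = x`
    refine bvy16A0_core p n hp hp3 hn h11 hpn M Aset hP h3p h9p h27p L₃ L₉ L₂₇ hw3 hw9 hw27 he3 he9 he27 hD3 hD9 hD27
      he1 hen hAB2 (a := Y) (b := x) (c := z)
      ⟨by rw [← heq']; push_cast; ring, hBY0, by simpa using hx0, by simpa using hz0, by simpa using hxBY.symm,
        by simpa using hBYz, by simpa using hxz⟩ ?_ ?_ (by rw [mul_comm]; exact hxY.1) (by rw [mul_comm]; exact hxY.2)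
    · intro h3
      have hu : IsUnit (3 : ℤ) := hxBY.isUnit_of_dvd' h3x h3
      rcases Int.isUnit_iff.mp hu with h | h <;> norm_num at h
    · have : (3 : ℤ) ∣ x ^ n := dvd_pow h3x (by omega)
      push_cast
      omega
  · by_cases h3b : (3 : ℤ) ∣ ((p ^ e : ℕ) : ℤ) * Y ^ n - 2
    · -- sign change: `(a, b, c) = (−x, −Y, −z)`
      refine bvy16A0_core p n hp hp3 hn h11 hpn M Aset hP h3p h9p h27p L₃ L₉ L₂₇ hw3 hw9 hw27 he3 he9 he27 hD3 hD9 hD27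
        he1 hen hAB1 (a := -x) (b := -Y) (c := -z)
        ⟨?_, by simpa using hx0, by simpa using hBY0, by simpa using hz0, by simpa using hxBY.neg_neg,
          by simpa using hxz.neg_neg, by simpa using hBYz.neg_neg⟩ (by simpa using h3x) ?_
        (by rw [neg_mul_neg]; exact hxY.1) (by rw [neg_mul_neg]; exact hxY.2)
      · rw [Nat.cast_one, one_mul, one_mul, hnx, hnY, hnz, ← heq']
        ring
      · rw [hnY, mul_neg]
        omega
    · -- already normal: `(a, b, c) = (x, Y, z)`
      exact bvy16A0_core p n hp hp3 hn h11 hpn M Aset hP h3p h9p h27p L₃ L₉ L₂₇ hw3 hw9 hw27 he3 he9 he27 hD3 hD9 hD27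
        he1 hen hAB1 (a := x) (b := Y) (c := z)
        ⟨by rw [← heq']; push_cast; ring, by simpa using hx0, hBY0, by simpa using hz0, by simpa using hxBY,
          by simpa using hxz, by simpa using hBYz⟩ (by simpa using h3x) h3b hxY.1 hxY.2

/-- **Generic row `(p, n)` of [BVY04, Thm 1.6], allowed-set-parametric, no L\* orbit (reduction theorem).** Under the named hypotheses of
`bvy16A0_core` (`BVY04PackageA Aset`, `DataComplete ×3`; every orbit of the three levels kernel-eliminated) and [DM97] for the sub-case `n ∣ α`
(then `p^α yⁿ = (p^k y)ⁿ` and the equation is `xⁿ + Yⁿ = z³`), the equation `xⁿ + p^α yⁿ = z³` has no solution in pairwise coprime integers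
with `|xy| > 1` for any `α ≥ 1`: `SH04Pair p n`. ADJACENT, NOT abc.
[cite: BennettVatsalYazdani2004, Thm 1.6 p.1400 (one pair (p,n), conditionally on the named inputs)] -/
theorem bvy16A0_pair (p n : ℕ) (hp : p.Prime) (hp3 : p ≠ 3) (hn : n.Prime) (h11 : 11 ≤ n) (hpn : p ≠ n)
    (M : CMNewformModel) (Aset : ℕ → List ℤ) (hP : M.BVY04PackageA Aset)
    {N₃ N₉ N₂₇ : ℕ} (h3p : 3 * p = N₃) (h9p : 9 * p = N₉) (h27p : 27 * p = N₂₇) (L₃ L₉ L₂₇ : List OrbitData)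
    (hw3 : ∀ o ∈ L₃, ∀ c ∈ o.coeffs, c.ell.Prime ∧ c.ell ≠ 2 ∧ ¬ c.ell ∣ N₃)
    (hw9 : ∀ o ∈ L₉, ∀ c ∈ o.coeffs, c.ell.Prime ∧ c.ell ≠ 2 ∧ ¬ c.ell ∣ N₉)
    (hw27 : ∀ o ∈ L₂₇, ∀ c ∈ o.coeffs, c.ell.Prime ∧ c.ell ≠ 2 ∧ ¬ c.ell ∣ N₂₇)
    (he3 : ∀ o ∈ L₃, o.Eliminated Aset n) (he9 : ∀ o ∈ L₉, o.Eliminated Aset n) (he27 : ∀ o ∈ L₂₇, o.Eliminated Aset n)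
    (hD3 : M.DataComplete N₃ L₃) (hD9 : M.DataComplete N₉ L₉) (hD27 : M.DataComplete N₂₇ L₂₇)
    (hDM : darmonMerel1997_sumOfPowersEqCube) : SH04Pair p n := by
  intro α hα x y z hxy hxz hyz hbig heq
  by_cases hnα : n ∣ α
  · -- `α = n k`: `xⁿ + (p^k y)ⁿ = z³`, excluded by [DM97]
    obtain ⟨k, rfl⟩ := hnα
    obtain ⟨hpx, -⟩ := sh04_prime_not_dvd hp hα (by omega : 0 < n) hxz heq
    have pP : Prime (p : ℤ) := Int.prime_iff_natAbs_prime.mpr (by simpa using hp)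
    have hcpx : IsCoprime (p : ℤ) x := pP.irreducible.coprime_iff_not_dvd.mpr hpx
    have hxY : IsCoprime x ((p : ℤ) ^ k * y) := (hcpx.symm.pow_right).mul_right hxy
    have hz0 : z ≠ 0 := by
      rintro rfl
      have hx1 := Int.isUnit_iff_abs_eq.mp (isCoprime_zero_right.mp hxz)
      have hy1 := Int.isUnit_iff_abs_eq.mp (isCoprime_zero_right.mp hyz)
      rw [abs_mul, hx1, hy1] at hbig
      norm_num at hbig
    have h1p : (1 : ℤ) ≤ |(p : ℤ)| := by
      rw [Nat.abs_cast]; exact_mod_cast hp.one_lt.le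
    have hbig' : 1 < |x * ((p : ℤ) ^ k * y)| := by
      rw [show x * ((p : ℤ) ^ k * y) = (p : ℤ) ^ k * (x * y) by ring, abs_mul]
      calc (1 : ℤ) = 1 * 1 := by norm_num
        _ < |(p : ℤ) ^ k| * |x * y| := by
          apply mul_lt_mul' _ hbig (by norm_num) (abs_pos.mpr (pow_ne_zero _ (by exact_mod_cast hp.ne_zero)))
          rw [abs_pow]; exact one_le_pow₀ h1p
    refine Literature.NumberTheory.DiophantineGeometry.BennettVatsalYazdani2004.thm81_one_of_darmonMerel hDM
      (n := n) (by omega) hz0 hxY hbig' ?_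
    rw [one_mul, ← heq]
    ring
  · exact bvy16A0_pair_of_not_dvd p n hp hp3 hn h11 hpn M Aset hP h3p h9p h27p L₃ L₉ L₂₇ hw3 hw9 hw27 he3 he9 he27
      hD3 hD9 hD27 α hα hnα x y z hxy hxz hyz hbig heq

end Summit.Ventures.AbcShadow
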